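import Mathlib
import HarnessLib
import Summits.RiemannHypothesis.RiemannHypothesis.Theses.WeilGroundState
import Literature.NumberTheory.LFunctions.WeilGroundState
import Literature.NumberTheory.LFunctions.WeilGroundStateRealZeros
import Literature.NumberTheory.LFunctions.RiemannXi
import Literature.NumberTheory.LFunctions.DeBruijnNewman
import Literature.Analysis.Complex.HadamardGenusZero

/-!
# Sketch — crux ideas for `GroundStatesConvergeToXi` (stmt-RiemannHypothesis-1527), ideator k = 2

First-lemma signatures for two crux idea cards (crux-ideate round 1; NO skeleton, nothing proved):

* `LaguerrePolyaRigidity` — card `laguerre-polya-two-coefficient-rigidity`;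
* `KreinNodes`            — card `krein-quadrature-nodes`.

All constants `lean search --decl`-checked: `Literature.NumberTheory.LFunctions.{weilMellin,
weilQuadratic, IsWeilTest, weilGroundEnergy, IsWeilGroundState, WeilWindowSimpleEven,
Connes2026_weilGroundState_zeros_re_eq_half, HasOnlyRealZeros, riemannXi, riemannXiUpper}`,
`Literature.Analysis.Complex.hadamard_genus_zero`, the route decl
`Summit.RiemannHypothesis.RiemannHypothesis.Theses.WeilGroundState.GroundStatesConvergeToXi`.
-/

noncomputable section

open scoped Topology
open Filter Set MeasureTheory Complex

namespace Summit.RiemannHypothesis.RiemannHypothesis.Cruxes.GroundStatesConvergeToXi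

open Literature.NumberTheory.LFunctions

/-! ## Common vocabulary: the Fourier side of a window function -/

/-- The Fourier side of a window function in the route's normalisation:
`F_u(z) := weilMellin u (1/2 + I z) = ∫ u(t) e^{izt} dt`, so that the crux's target reads
`c · F_u → Ξ := riemannXiUpper` (`Ξ(z) = ξ(1/2 + iz)`), "zeros on `Re s = 1/2`" reads
"real zeros of `F_u`", and `s ↦ 1 - s` reads `z ↦ -z`. -/
def fourierSide (u : ℝ → ℂ) (z : ℂ) : ℂ :=
  weilMellin u (1 / 2 + I * z)

/-- The two-coefficient functional `σ(F) := Re (−F''(0) / (2 F(0)))`. For an even entire `F` with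
only real zeros `±x_n` and `F(0) ≠ 0` of exponential type, `σ(F) = Σ_n x_n^{-2}` (genus-zero
Hadamard product in the variable `z²`). For `F = F_u`, `σ(F_u) = (∫ t² u) / (2 ∫ u)`:
half the normalised second moment of the window function. -/
def lpTrace (F : ℂ → ℂ) : ℝ :=
  (-(iteratedDeriv 2 F 0) / (2 * F 0)).re

/-- `σ_Ξ := σ(Ξ) = ξ''(1/2) / (2 ξ(1/2)) = Σ_ρ Re (ρ − 1/2)^{-2}·(−1) …`; under RH `= Σ_{γ>0} γ^{-2}`
(= 0.0231049931…, all zeros; numerically `W_Φ/2` with `W_Φ = 0.0462099862`, job j015361). -/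
def xiTrace : ℝ :=
  lpTrace riemannXiUpper

/-- The class in which the lever works: entire, even, real on `ℝ`, only real zeros, exponential
type, non-vanishing at the origin. For ground-state transforms this is exactly what route items
#2 (`GroundStateSimpleEven`) + #4 (`GroundStateMellinRealZeros`, C–vS Thm 6.1) deliver, plus
the nondegenerate mean `∫ u ≠ 0`. -/
def IsEvenRealRooted (F : ℂ → ℂ) : Prop :=
  Differentiable ℂ F ∧ (∀ z, F (-z) = F z) ∧ (∀ x : ℝ, (F x).im = 0) ∧
    HasOnlyRealZeros F ∧ (∃ A B : ℝ, ∀ z, ‖F z‖ ≤ A * Real.exp (B * ‖z‖)) ∧ F 0 ≠ 0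

namespace LaguerrePolyaRigidity

/-! ## Card `laguerre-polya-two-coefficient-rigidity` -/

/-- (L1) **Gaussian majorant from two Taylor coefficients** (Laguerre–Pólya; Pólya 1913,
Boas Thm 2.8.2): for `F` even, real-rooted, of exponential type with `F(0) ≠ 0`,
`σ(F) ≥ 0` and `‖F z‖ ≤ ‖F 0‖ · exp(σ(F) ‖z‖²)` on all of `ℂ`.
PROVABLE NOW: apply the tree's `Literature.Analysis.Complex.hadamard_genus_zero_holds` to
`G(w) := F(√w)` (entire of order ≤ 1/2, zeros `x_n² > 0`): `F(z) = F(0) ∏ (1 − z²/x_n²)`,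
`Σ x_n^{-2} = σ(F)`, and `|1 − z²/x²| ≤ 1 + |z|²/x² ≤ exp(|z|²/x²)`. -/
def GaussianMajorant : Prop :=
  ∀ F : ℂ → ℂ, IsEvenRealRooted F →
    0 ≤ lpTrace F ∧ ∀ z : ℂ, ‖F z‖ ≤ ‖F 0‖ * Real.exp (lpTrace F * ‖z‖ ^ 2)

/-- (L2) **Trace rigidity** (the identification half of the lever): a sequence of even
real-rooted exponential-type `F_k` with `F_k(0) → Ξ(0)`, `limsup σ(F_k) ≤ σ_Ξ`, and
`F_k^{(j)}(z₀) → 0` for every zero `z₀` of `Ξ` and every `j` below its multiplicity, converges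
to `Ξ` locally uniformly on `ℂ`. Mechanism: (L1) ⇒ normal family; a limit point `F` is even,
real-rooted (Hurwitz, tree) with `F(z) = F(0) e^{−α z²} ∏ (1 − z²/y_n²)`, `α ≥ 0` the mass of
zeros escaped to `∞`; divisor inclusion `{zeros of Ξ} ⊆ {±y_n}` and the trace inequality
`α + Σ y_n^{-2} = lim σ(F_k) ≤ σ_Ξ = Σ_γ γ^{-2}` force `α = 0` and no extra zeros: `F = Ξ`. -/
def TraceRigidity : Prop :=
  ∀ F : ℕ → ℂ → ℂ, (∀ k, IsEvenRealRooted (F k)) →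
    Tendsto (fun k => F k 0) atTop (𝓝 (riemannXiUpper 0)) →
    (∀ η : ℝ, 0 < η → ∀ᶠ k in atTop, lpTrace (F k) ≤ xiTrace + η) →
    (∀ z₀ : ℂ, ∀ j : ℕ, (∀ i ≤ j, iteratedDeriv i riemannXiUpper z₀ = 0) →
        Tendsto (fun k => iteratedDeriv j (F k) z₀) atTop (𝓝 0)) →
    TendstoLocallyUniformly (fun k z => F k z) riemannXiUpper atTop

/-- (L3) **Dictionary**: for a real, even ground state `u` at window `a`, `F_u` is entire, even,
real on `ℝ`, of exponential type `a`, with `F_u(0) = ∫ u` and `F_u''(0) = −∫ t² u`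
(differentiation under the integral: `IsWeilGroundState.hasDerivAt_weilMellin`, tree). -/
def FourierSideDictionary : Prop :=
  ∀ (a : ℝ) (u : ℝ → ℂ), IsWeilGroundState a u → (∀ t, u (-t) = u t) → (∀ t, (u t).im = 0) →
    Differentiable ℂ (fourierSide u) ∧ (∀ z, fourierSide u (-z) = fourierSide u z) ∧
    (∀ x : ℝ, (fourierSide u x).im = 0) ∧
    (∀ z, ‖fourierSide u z‖ ≤ Real.sqrt (2 * a) * Real.exp (a * ‖z‖)) ∧
    fourierSide u 0 = ∫ t, u t ∧
    iteratedDeriv 2 (fourierSide u) 0 = -∫ t : ℝ, ((t : ℂ) ^ 2) * u t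

/-- (L4) **Real zeros from the route's own items**: under the C–vS fact (route item #4 in fact
form) a window where the bottom is simple and even (the window clause of route item #2) has
ground states whose Fourier side has only real zeros. (One line from the fact: `Re s = 1/2 ↔
Im z = 0` under `s = 1/2 + I z`.) -/
def RealZerosOnFourierSide : Prop :=
  Connes2026_weilGroundState_zeros_re_eq_half →
    ∀ (a : ℝ) (u : ℝ → ℂ), WeilWindowSimpleEven a → IsWeilGroundState a u →
      HasOnlyRealZeros (fourierSide u)

/-- (T) **The transfer target C⁺ (moment form).** Along some windows `a_k → ∞` with simple even
bottoms there are real even ground states `u_k` with (i) nondegenerate mean `∫ u_k ≠ 0`, (ii) the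
WIDTH INEQUALITY `limsup (∫ t² u_k)/(2 ∫ u_k) ≤ σ_Ξ` ("ground states are asymptotically no wider
than Pólya's kernel `Φ`", `∫t²Φ/∫Φ = ξ''(½)/ξ(½) = 0.046209986…`), and (iii) the normalised
transforms `(Ξ(0)/∫u_k) · F_{u_k}` die, with multiplicity, at every zero of `Ξ` (the RH-carrying
clause: false under ¬RH, free under RH from `ε(a_k) → 0⁺`). With (L1)–(L4) this gives the crux
with `c_k := Ξ(0)/∫u_k`, on all of `ℂ` (not only the strip). -/
def GroundStateMomentConvergence : Prop :=
  ∃ a : ℕ → ℝ, ∃ u : ℕ → ℝ → ℂ, Tendsto a atTop atTop ∧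
    (∀ k, IsWeilGroundState (a k) (u k) ∧ (∀ t, u k (-t) = u k t) ∧ (∀ t, (u k t).im = 0) ∧
      WeilWindowSimpleEven (a k)) ∧
    (∀ᶠ k in atTop, (∫ t, u k t) ≠ 0) ∧
    (∀ η : ℝ, 0 < η → ∀ᶠ k in atTop,
      ((∫ t : ℝ, ((t : ℂ) ^ 2) * u k t) / (2 * ∫ t, u k t)).re ≤ xiTrace + η) ∧
    (∀ z₀ : ℂ, ∀ j : ℕ, (∀ i ≤ j, iteratedDeriv i riemannXiUpper z₀ = 0) →
      Tendsto (fun k => (riemannXiUpper 0 / fourierSide (u k) 0) *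
        iteratedDeriv j (fourierSide (u k)) z₀) atTop (𝓝 0))

/-- (T′) The same target in ZERO form (the face used by card `krein-quadrature-nodes`): (ii) is
literally `limsup Σ_{x ∈ Z(F_{u_k}), x > 0} x^{-2} ≤ Σ_γ γ^{-2}` and (iii) is "the zeros of
`F_{u_k}` in every bounded interval converge, with multiplicity, to the zeta ordinates". Stated
with zero-counting in closed balls via `Nat.card`. -/
def GroundStateZeroConvergence : Prop :=
  ∃ a : ℕ → ℝ, ∃ u : ℕ → ℝ → ℂ, Tendsto a atTop atTop ∧
    (∀ k, IsWeilGroundState (a k) (u k) ∧ (∀ t, u k (-t) = u k t) ∧ (∀ t, (u k t).im = 0) ∧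
      WeilWindowSimpleEven (a k)) ∧
    (∀ᶠ k in atTop, (∫ t, u k t) ≠ 0) ∧
    (∀ η : ℝ, 0 < η → ∀ᶠ k in atTop,
      ((∫ t : ℝ, ((t : ℂ) ^ 2) * u k t) / (2 * ∫ t, u k t)).re ≤ xiTrace + η) ∧
    (∀ (x₀ r : ℝ), 0 < r → (∀ z : ℂ, ‖z - x₀‖ = r → riemannXiUpper z ≠ 0) → ∀ᶠ k in atTop,
      Nat.card {z : ℂ // ‖z - x₀‖ < r ∧ fourierSide (u k) z = 0} =
        Nat.card {z : ℂ // ‖z - x₀‖ < r ∧ riemannXiUpper z = 0})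

/-- (G) The glue the crux-plan stage would have to check (NOT proved here; stated to make sure it
typechecks against the route decl BY NAME). -/
def Glue : Prop :=
  GaussianMajorant → TraceRigidity → FourierSideDictionary → RealZerosOnFourierSide →
    Connes2026_weilGroundState_zeros_re_eq_half → GroundStateMomentConvergence →
      Summit.RiemannHypothesis.RiemannHypothesis.Theses.WeilGroundState.GroundStatesConvergeToXi

/-- Finite-window NECESSARY CONDITIONS of the lever (what job j015361/j015376 test): at any window
with simple even bottom and a real even ground state `u` with `∫ u > 0`, all even moments are
`≥ 0`, the polar ratio `∫ u cosh(t/2) / ∫ u` lies in `[1, exp((∫t²u/∫u)/8)]`, and the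
Laguerre–Turán inequalities hold for `b_j := (∫ t^{2j} u)/(2j)!`. (LP consequences of C–vS; a
certified violation at one window refutes route item #2 at that window or the dictionary #4.) -/
def FiniteWindowLPConditions : Prop :=
  Connes2026_weilGroundState_zeros_re_eq_half →
    ∀ (a : ℝ) (u : ℝ → ℂ), WeilWindowSimpleEven a → IsWeilGroundState a u →
      (∀ t, u (-t) = u t) → (∀ t, (u t).im = 0) → 0 < (∫ t, u t).re →
        (∀ j : ℕ, 0 ≤ (∫ t : ℝ, ((t : ℂ) ^ (2 * j)) * u t).re) ∧
        (∫ t, u t).re ≤ (∫ t : ℝ, (Real.cosh (t / 2) : ℂ) * u t).re ∧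
        (∫ t : ℝ, (Real.cosh (t / 2) : ℂ) * u t).re ≤
          (∫ t, u t).re * Real.exp ((∫ t : ℝ, ((t : ℂ) ^ 2) * u t).re / (∫ t, u t).re / 8)

end LaguerrePolyaRigidity

namespace KreinNodes

/-! ## Card `krein-quadrature-nodes` -/

/-- A positive measure on the Fourier line SUB-representing the window form shifted by `ε`:
`∫ |ĝ(x)|² dμ(x) ≤ Re Q(g) − ε ‖g‖²` for all test functions on the window. (Fatou-safe: vague
limits of representing measures are sub-representing.) -/
def IsSubRepresenting (a ε : ℝ) (μ : Measure ℝ) : Prop :=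
  IsLocallyFiniteMeasure μ ∧ ∀ g : ℝ → ℂ, IsWeilTest g → tsupport g ⊆ Icc (-a) a →
    ∫ x, ‖weilMellin g (1 / 2 + I * x)‖ ^ 2 ∂μ ≤ (weilQuadratic g).re - ε * ∫ t, ‖g t‖ ^ 2

/-- A positive measure REPRESENTING the shifted window form (a Krein extension of the positive
definite distribution `W − ε δ₀` from `(−2a, 2a)` to `ℝ`, read on the Fourier side; in the
trigonometric truncations of Connes–van Suijlekom these are the Carathéodory–Fejér measures). -/
def IsRepresenting (a ε : ℝ) (μ : Measure ℝ) : Prop :=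
  IsLocallyFiniteMeasure μ ∧ ∀ g : ℝ → ℂ, IsWeilTest g → tsupport g ⊆ Icc (-a) a →
    ∫ x, ‖weilMellin g (1 / 2 + I * x)‖ ^ 2 ∂μ = (weilQuadratic g).re - ε * ∫ t, ‖g t‖ ^ 2

/-- (K0) **Existence** of a representing measure at the ground energy `ε(a)` for every window
(M. G. Krein's extension theorem for positive definite kernels on an interval, 1940; for the
distribution kernel here via the C–vS finite sections + Helly — the equality (vs. the Fatou
inequality) is the first thing the line must settle). -/
def KreinMeasureExists : Prop :=
  ∀ a : ℝ, 0 < a → ∃ μ : Measure ℝ, IsRepresenting a (weilGroundEnergy a) μ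

/-- (K1) **Nodes are zeros** — PROVABLE NOW, two lines: for a ground state `u`,
`∫ |F_u|² dμ ≤ Q̄(u) − ε(a)‖u‖² = 0` (closure along the minimising sequence + Fatou for the
locally uniform convergence `ĝ_n → F_u`), so `μ` lives on the zero set of the entire function
`F_u`: every (sub-)representing measure at the ground energy is purely atomic with atoms at real
zeros of the ground-state transform. -/
def NodesAreZeros : Prop :=
  ∀ (a : ℝ) (μ : Measure ℝ) (u : ℝ → ℂ), IsSubRepresenting a (weilGroundEnergy a) μ →
    IsWeilGroundState a u → μ {x : ℝ | weilMellin u (1 / 2 + I * x) ≠ 0} = 0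

/-- (K2) **Uniform local bounds from positivity**: the mass of `[−T, T]` under any
sub-representing measure at level `ε` on a window `a ≥ 1` is bounded by a constant depending on
`T` only, plus `max 0 (−ε)` times a constant (test one fixed bump). So along windows where the
ground energy does not run off to `−∞` the node measures are vaguely precompact. -/
def UniformLocalBounds : Prop :=
  ∀ T : ℝ, ∃ C : ℝ, ∀ (a ε : ℝ) (μ : Measure ℝ), 1 ≤ a → IsSubRepresenting a ε μ →
    (μ (Icc (-T) T)).toReal ≤ C * (1 + max 0 (-ε))

/-- (K3) **Quadrature nodes converge to the zeta ordinates** (the convergence mechanism; its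
energy hypothesis is where RH enters this face of the crux): if `ε(a_k) → 0` then any
representing measures `μ_k` at the ground energies converge vaguely to the Weil spectral measure
(the unique positive measure whose Fourier transform is the Weil distribution, which then
exists), whose atoms in a bounded interval are the ordinates `γ` with masses their
multiplicities; with (K1): every neighbourhood of every ordinate eventually contains a real zero
of the ground-state transform. -/
def NodesReachOrdinates : Prop :=
  ∀ (a : ℕ → ℝ) (u : ℕ → ℝ → ℂ) (μ : ℕ → Measure ℝ), Tendsto a atTop atTop →
    (∀ k, IsWeilGroundState (a k) (u k) ∧ IsRepresenting (a k) (weilGroundEnergy (a k)) (μ k)) →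
    Tendsto (fun k => weilGroundEnergy (a k)) atTop (𝓝 0) →
      ∀ γ : ℝ, riemannXi (1 / 2 + I * γ) = 0 → ∀ r : ℝ, 0 < r → ∀ᶠ k in atTop,
        ∃ x ∈ Ioo (γ - r) (γ + r), weilMellin (u k) (1 / 2 + I * x) = 0

/-- (K4) **Atomic representation on the zero set** (K1 + representation, the form in which the
line uses the quadrature: the shifted window energy of ANY test function is a weighted sum of
`|ĝ|²` over the real zeros of the ground-state transform; the weight of a simple node `x₀` is
then the shifted energy of the Lagrange/Paley–Wiener function `F_u(z)/((z − x₀)F_u′(x₀))`, a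
remark the line states with the closed form). -/
def AtomicRepresentation : Prop :=
  ∀ (a : ℝ) (μ : Measure ℝ) (u g : ℝ → ℂ), IsRepresenting a (weilGroundEnergy a) μ →
    IsWeilGroundState a u → IsWeilTest g → tsupport g ⊆ Icc (-a) a →
      (weilQuadratic g).re - weilGroundEnergy a * ∫ t, ‖g t‖ ^ 2 =
        ∑' x : {x : ℝ // weilMellin u (1 / 2 + I * x) = 0},
          (μ {x.1}).toReal * ‖weilMellin g (1 / 2 + I * x.1)‖ ^ 2

end KreinNodes

end Summit.RiemannHypothesis.RiemannHypothesis.Cruxes.GroundStatesConvergeToXi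

end
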